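import Literature.NumberTheory.LFunctions.ThetaChainFreeCheck
import HarnessLib

/-!
# Schoenfeld's `θ`-bound on `[599, 10⁸]` by kernel computation: data-free run, chunk 15 of 35

Topic: `Literature/NumberTheory/LFunctions`. Pure proof file (a kernel computation; nothing is
asserted, no definition). The theorems below evaluate `ThetaChain.runFree` — together `150000`
data-free steps of the certified `θ`-chain (`ThetaChain.stepFree`, `ThetaChainFreeCheck.lean`: the
next prime found and certified by two gcds with the primorials of the odd primes `≤ 2999` and in
`(2999, 10007]`, the enclosures of `log p` and `θ(p)`, and the two comparisons behind
`|θ(x) − x| ≤ √x log² x/(8π)`) — from the state at the prime `44598077` to the state at the prime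
`47241913`. Soundness: `ThetaChain.runFree_sound`; assembly of the 35 chunks: `ThetaUpTo1e8.lean`.
The expected states were obtained by evaluating a twin of the same function outside the kernel
(validated bit-for-bit on the tree's chunk `ThetaChainRun.xrun14`). Declarations of `5·10⁴` steps
(about `70 s` of kernel time each; the kernel's evaluation is linear within a declaration of this size),
`decide +kernel`, standard axioms only (`maxHeartbeats 0` lifts the deterministic time-out).

## References

* L. Schoenfeld, *Sharper bounds for the Chebyshev functions θ(x) and ψ(x). II*, Math. Comp. 30
  (1976), 337–360, Thm. 10 (6.3). [Schoenfeld1976]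
* J. B. Rosser, L. Schoenfeld, *Approximate formulas for some functions of prime numbers*,
  Illinois J. Math. 6 (1962), 64–94, Thms. 18–19 (`θ`-tables to `10⁸`). [RosserSchoenfeld1962]
-/

namespace Literature.NumberTheory.LFunctions.ThetaChainRun

open ThetaChain

set_option maxHeartbeats 0 in
/-- **Data-free certified `θ`-run, chunk 15a** (steps `2100001`–`2150000` after `8886113`: 50000 primes,
`44598077` to `45475739`). [cite: Schoenfeld1976, Thm. 10 (6.3)] -/
theorem frun15a :
    runFree 50000
      ⟨44598077, 21293053816997555200422638, 21293053816998030861754505, 53905941993206703394159255090309, 53905941993207985391656577212393⟩ =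
    some ⟨45475739, 21316613645599731537274765, 21316613645600207199560962, 54971186621571401223677438507869, 54971186621572707004265212611458⟩ := by
  decide +kernel

set_option maxHeartbeats 0 in
/-- **Data-free certified `θ`-run, chunk 15b** (steps `2150001`–`2200000` after `8886113`: 50000 primes,
`45475739` to `46359037`). [cite: Schoenfeld1976, Thm. 10 (6.3)] -/
theorem frun15b :
    runFree 50000
      ⟨45475739, 21316613645599731537274765, 21316613645600207199560962, 54971186621571401223677438507869, 54971186621572707004265212611458⟩ =
    some ⟨46359037, 21339870079306109879410568, 21339870079306585542651445, 56037600189272805217624280773335, 56037600189274134781350235219039⟩ := by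
  decide +kernel

set_option maxHeartbeats 0 in
/-- **Data-free certified `θ`-run, chunk 15c** (steps `2200001`–`2250000` after `8886113`: 50000 primes,
`46359037` to `47241913`). [cite: Schoenfeld1976, Thm. 10 (6.3)] -/
theorem frun15c :
    runFree 50000
      ⟨46359037, 21339870079306109879410568, 21339870079306585542651445, 56037600189272805217624280773335, 56037600189274134781350235219039⟩ =
    some ⟨47241913, 21362676754810235021289468, 21362676754810710685484625, 57105165227195634657305921913649, 57105165227196988004217776506138⟩ := by
  decide +kernel

end Literature.NumberTheory.LFunctions.ThetaChainRun
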